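import Mathlib
import Summits.Ventures.PercRepro.TriangleCapStabTableAll
import Summits.Ventures.PercRepro.TriangleCapRowA1Six

/-!
# PercRepro — THE NON-BIPARTITE STABILITY TABLE ON EVERY CELL `r ≤ a + 1` OF EVERY ROW `5 ≤ a ≤ 18`, WITH
`r = a + 1` ON THE ROWS `a ≥ 6` (p3, gen 47; part 200zc)

`stab_table_all` of part 200w asked `a ≥ 8` on the cell `r = a + 1`; with the row `r = a + 1` for every `a ≥ 6`
(part 200zb) the condition weakens to `a ≥ 6`: only the cell `(k, 5, 6)` of the table `r ≤ a + 1`, `5 ≤ a ≤ 18`,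
stays open. Axioms: standard.
-/

namespace PercRepro

namespace TriangleCap

namespace C047

open Finset

/-- **THE NON-BIPARTITE STABILITY TABLE ON EVERY CELL `r ≤ a + 1` OF EVERY ROW `5 ≤ a ≤ 18`** (`r = a + 1` for
`a ≥ 6`), `3a + 1 ≤ k`: every non-`a`-bipartite `K₄⁻`-free graph on `Fin k` with `a (k − a) − r` edges has
`Σ_v d(v)² + r (k − 1 − r) + stabGapAll k a r ≤ m k`, and the value is attained by a non-`a`-bipartite graph. -/
theorem stab_table_all' (k a r : ℕ) (ha5 : 5 ≤ a) (ha18 : a ≤ 18) (hr : r ≤ a + 1) (h6 : r = a + 1 → 6 ≤ a)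
    (hk : 3 * a + 1 ≤ k) :
    (∀ (D : SimpleGraph (Fin k)) [DecidableRel D.Adj], K4mFree D → D.edgeFinset.card + r = a * (k - a) →
        (¬ ∃ A : Finset (Fin k), A.card = a ∧ BipSub D A) →
        ∑ v, deg D v * deg D v + r * (k - 1 - r) + stabGapAll k a r ≤ D.edgeFinset.card * k) ∧
      ∃ (D : SimpleGraph (Fin k)) (_ : DecidableRel D.Adj), K4mFree D ∧ D.edgeFinset.card + r = a * (k - a) ∧
        (¬ ∃ A : Finset (Fin k), A.card = a ∧ BipSub D A) ∧
        ∑ v, deg D v * deg D v + r * (k - 1 - r) + stabGapAll k a r = D.edgeFinset.card * k := by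
  rcases Nat.lt_or_ge r (a + 1) with hra | hra
  · exact stab_table_all k a r ha5 ha18 hr (fun h => by omega) hk
  · have hr' : r = a + 1 := by omega
    subst hr'
    have hgap : stabGapAll k a (a + 1) = 2 * k - 10 := by
      unfold stabGapAll
      have h3 : ¬ (a + 1 + 3 ≤ a) := by omega
      have h1 : ¬ (a + 1 + 1 ≤ a) := by omega
      simp [h3, h1]
    rw [hgap]
    exact rowA1_nonbip_second_best' k a (h6 rfl) ha18 hk

end C047

end TriangleCap

end PercRepro
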